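import Mathlib
import Summits.Ventures.PercRepro2.IteratedBK
import Summits.Ventures.PercRepro2.IFRConv
import Summits.Ventures.PercRepro2.IFRSP

/-!
# The packing tail of an increasing predicate inside a part, and its composition calculus
(seat mine-b, cell pub-perc-repro2)

`genIn A E₁ k` is the event that the open edges inside the part `E₁` contain `k` pairwise disjoint
witnesses of the predicate `A` (the `k`-fold disjoint occurrence `kDisj A k` of `IteratedBK.lean`,
restricted to `E₁`); `genTail p A E₁` is its tail as a function on `ℤ`.  Both rows B2 (max-flow,
`A = Carries`) and B2* (disjoint closed cuts, `A = SeparatesIn` in the complementary configuration)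
are instances.  This file and `GenTailComp.lean` prove, once and for all, the facts the series–parallel
induction needs, with the combinatorial split as an abstract hypothesis:

* `isLCTail_genTail`: log-concavity at every level gives an `IsLCTail` with support bound `|E₁| + 1`;
* `genIn_logconcave_of_no_three`: a part with no three disjoint witnesses is log-concave by the BK
  inequality alone (`bk_weighted`);
* (`GenTailComp.lean`) the SUM-type and MIN-type composition theorems `isLCTail_genTail_sum` /
  `isLCTail_genTail_min` (convolution resp. product of the tails).
-/

open Finset

namespace Summit.Ventures.PercRepro2

open IFR

section Events

variable {E : Type*} [Fintype E] [DecidableEq E]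

/-- **`k` disjoint witnesses of `A` among the open edges of the part `E₁`** -/
def genIn (A : Finset E → Prop) (E₁ : Finset E) (k : ℕ) : Set (Config E) :=
  {ω | kDisj A k (openSet ω ∩ E₁)}

omit [Fintype E] [DecidableEq E] in
/-- `k + 1` disjoint witnesses contain `k` -/
lemma kDisj_of_succ' {A : Finset E → Prop} {k : ℕ} {S : Finset E} (h : kDisj A (k + 1) S) : kDisj A k S := by
  obtain ⟨_, L, _, hL, _, _, hB⟩ := h
  exact incr_kDisj A k hL (hB L le_rfl)

/-- the events are nested -/
lemma genIn_succ_subset (A : Finset E → Prop) (E₁ : Finset E) (k : ℕ) :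
    genIn A E₁ (k + 1) ⊆ genIn A E₁ k := fun _ h => kDisj_of_succ' h

/-- the events are antitone in the level -/
lemma genIn_anti (A : Finset E → Prop) (E₁ : Finset E) : Antitone (genIn A E₁) :=
  antitone_nat_of_succ_le (genIn_succ_subset A E₁)

/-- level `0` is everything -/
lemma genIn_zero (A : Finset E → Prop) (E₁ : Finset E) : genIn A E₁ 0 = Set.univ := by
  ext ω; simp [genIn, kDisj]

omit [Fintype E] in
/-- `k` disjoint nonempty witnesses inside `S` need `k ≤ |S|` -/
lemma kDisj_le_card_of_not_empty {A : Finset E → Prop} (hA0 : ¬ A ∅) :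
    ∀ (k : ℕ) {S : Finset E}, kDisj A k S → k ≤ S.card
  | 0, _, _ => Nat.zero_le _
  | k + 1, S, h => by
      obtain ⟨K, L, hK, hL, hKL, hA, hB⟩ := h
      have hKne : K.Nonempty := by
        rw [Finset.nonempty_iff_ne_empty]
        rintro rfl
        exact hA0 (hA ∅ le_rfl)
      have h1 := kDisj_le_card_of_not_empty hA0 k (hB L le_rfl)
      have h2 : L.card + K.card ≤ S.card := by
        rw [← Finset.card_union_of_disjoint hKL.symm]
        exact Finset.card_le_card (Finset.union_subset hL hK)
      have h3 : 1 ≤ K.card := Finset.card_pos.2 hKne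
      omega

/-- beyond the size of the part the event is empty -/
lemma genIn_eq_empty {A : Finset E → Prop} (hA0 : ¬ A ∅) (E₁ : Finset E) {k : ℕ}
    (hk : E₁.card < k) : genIn A E₁ k = ∅ := by
  ext ω
  simp only [genIn, Set.mem_setOf_eq, Set.mem_empty_iff_false, iff_false]
  intro h
  have := kDisj_le_card_of_not_empty hA0 k h
  have h2 : (openSet ω ∩ E₁).card ≤ E₁.card := Finset.card_le_card Finset.inter_subset_right
  omega

/-- the event depends only on the edges of the part -/
lemma dependsOn_genIn (A : Finset E → Prop) (E₁ : Finset E) (k : ℕ) :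
    DependsOn (· ∈ genIn A E₁ k) (E₁ : Set E) := by
  intro ω ω' h
  have : openSet ω ∩ E₁ = openSet ω' ∩ E₁ := by
    ext e
    simp only [openSet, Finset.mem_inter, Finset.mem_filter, Finset.mem_univ, true_and]
    constructor
    · rintro ⟨h1, h2⟩; exact ⟨by rw [← h e h2]; exact h1, h2⟩
    · rintro ⟨h1, h2⟩; exact ⟨by rw [h e h2]; exact h1, h2⟩
  simp only [genIn, Set.mem_setOf_eq, this]

/-- the level `= j` -/
def genLevel (A : Finset E → Prop) (E₁ : Finset E) (j : ℕ) : Set (Config E) :=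
  genIn A E₁ j \ genIn A E₁ (j + 1)

/-- the level depends only on the edges of the part -/
lemma dependsOn_genLevel (A : Finset E → Prop) (E₁ : Finset E) (j : ℕ) :
    DependsOn (· ∈ genLevel A E₁ j) (E₁ : Set E) := by
  have h := dependsOn_inter (dependsOn_genIn A E₁ j) (dependsOn_compl (dependsOn_genIn A E₁ (j + 1)))
  rw [Set.union_self] at h
  exact h

/-- **levels partition**: `P(X ∩ {level < N+1}) = Σ_{j ≤ N} P(X ∩ {level = j})` -/
lemma prob_inter_compl_genIn_eq_sum (p : E → ℝ) (A : Finset E → Prop) (E₁ : Finset E)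
    (X : Set (Config E)) : ∀ N : ℕ,
    prob p (X ∩ (genIn A E₁ (N + 1))ᶜ) = ∑ j ∈ Finset.range (N + 1), prob p (X ∩ genLevel A E₁ j)
  | 0 => by
      rw [Finset.sum_range_one]
      congr 1
      ext ω
      simp [genLevel, genIn_zero]
  | N + 1 => by
      rw [Finset.sum_range_succ, ← prob_inter_compl_genIn_eq_sum p A E₁ X N]
      rw [← prob_union_of_disjoint]
      · congr 1
        ext ω
        simp only [Set.mem_inter_iff, Set.mem_compl_iff, Set.mem_union, genLevel, Set.mem_sdiff]
        have hsub := genIn_succ_subset A E₁ (N + 1)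
        constructor
        · rintro ⟨hX, hn⟩
          by_cases h1 : ω ∈ genIn A E₁ (N + 1)
          · exact Or.inr ⟨hX, h1, hn⟩
          · exact Or.inl ⟨hX, h1⟩
        · rintro (⟨hX, hn⟩ | ⟨hX, _, hn⟩)
          · exact ⟨hX, fun h => hn (hsub h)⟩
          · exact ⟨hX, hn⟩
      · rw [Set.disjoint_left]
        rintro ω ⟨_, hn⟩ ⟨_, h1, _⟩
        exact hn h1

end Events

section Tail

variable {E : Type*} [Fintype E] [DecidableEq E]

/-- **the packing tail of a part** as a function on `ℤ`: `P(level ≥ k)`, `1` for `k ≤ 0` -/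
noncomputable def genTail (p : E → ℝ) (A : Finset E → Prop) (E₁ : Finset E) (k : ℤ) : ℝ :=
  if k ≤ 0 then 1 else prob p (genIn A E₁ k.toNat)

/-- the tail is `1` at nonpositive indices -/
lemma genTail_of_nonpos (p : E → ℝ) (A : Finset E → Prop) (E₁ : Finset E) {k : ℤ} (hk : k ≤ 0) :
    genTail p A E₁ k = 1 := by simp [genTail, hk]

/-- the tail at a positive index is the event probability -/
lemma genTail_of_pos (p : E → ℝ) (A : Finset E → Prop) (E₁ : Finset E) {k : ℤ} (hk : 0 < k) :
    genTail p A E₁ k = prob p (genIn A E₁ k.toNat) := by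
  simp [genTail, not_le.2 hk]

/-- the tail at a natural index -/
lemma genTail_natCast (p : E → ℝ) (A : Finset E → Prop) (E₁ : Finset E) (k : ℕ) :
    genTail p A E₁ (k : ℤ) = prob p (genIn A E₁ k) := by
  rcases Nat.eq_zero_or_pos k with h | h
  · subst h; simp [genTail, genIn_zero]
  · rw [genTail_of_pos _ _ _ (by exact_mod_cast h)]; simp

/-- `P(level = j) = P(level ≥ j) − P(level ≥ j+1)` -/
lemma prob_genLevel (p : E → ℝ) (A : Finset E → Prop) (E₁ : Finset E) (j : ℕ) :
    prob p (genLevel A E₁ j) = prob p (genIn A E₁ j) - prob p (genIn A E₁ (j + 1)) := by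
  have h := prob_union_of_disjoint p (A := genIn A E₁ (j + 1)) (B := genLevel A E₁ j)
    (Set.disjoint_sdiff_right)
  have hu : genIn A E₁ (j + 1) ∪ genLevel A E₁ j = genIn A E₁ j := by
    unfold genLevel
    exact Set.union_sdiff_cancel (genIn_succ_subset A E₁ j)
  rw [hu] at h
  linarith

/-- the pmf of the tail at a natural index is the level probability -/
lemma pmf_genTail (p : E → ℝ) (A : Finset E → Prop) (E₁ : Finset E) (j : ℕ) :
    IsLCTail.pmf (genTail p A E₁) (j : ℤ) = prob p (genLevel A E₁ j) := by
  unfold IsLCTail.pmf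
  rw [prob_genLevel, genTail_natCast]
  have : ((j : ℤ) + 1) = ((j + 1 : ℕ) : ℤ) := by push_cast; ring
  rw [this, genTail_natCast]

/-- the tail of a part vanishes beyond its size -/
lemma genTail_eq_zero {p : E → ℝ} {A : Finset E → Prop} (hA0 : ¬ A ∅) (E₁ : Finset E) {k : ℤ}
    (hk : (E₁.card : ℤ) + 1 ≤ k) : genTail p A E₁ k = 0 := by
  rw [genTail_of_pos _ _ _ (by omega), genIn_eq_empty hA0 E₁ (by omega), prob_empty]

/-- **log-concavity at every level gives a log-concave tail** with support bound `|E₁| + 1` -/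
theorem isLCTail_genTail {p : E → ℝ} (hp : IsProbVec p) {A : Finset E → Prop} (hA0 : ¬ A ∅)
    (E₁ : Finset E)
    (hlc : ∀ k : ℕ, prob p (genIn A E₁ k) * prob p (genIn A E₁ (k + 2))
      ≤ prob p (genIn A E₁ (k + 1)) * prob p (genIn A E₁ (k + 1))) :
    IsLCTail (genTail p A E₁) ((E₁.card : ℤ) + 1) where
  one := fun k hk => genTail_of_nonpos _ _ _ hk
  nonneg := by
    intro k
    unfold genTail
    split_ifs
    · exact zero_le_one
    · exact prob_nonneg hp _
  anti := by
    intro k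
    rcases le_or_gt k (-1) with hk | hk
    · rw [genTail_of_nonpos _ _ _ (by omega), genTail_of_nonpos _ _ _ (by omega)]
    · rcases eq_or_lt_of_le (show 0 ≤ k by omega) with h0 | hpos
      · subst h0
        rw [genTail_of_nonpos _ _ _ le_rfl]
        unfold genTail
        simp only [show ¬ ((0 : ℤ) + 1 ≤ 0) by norm_num, if_false]
        exact prob_le_one hp _
      · rw [genTail_of_pos _ _ _ hpos, genTail_of_pos _ _ _ (by omega)]
        apply prob_mono hp
        have e : (k + 1).toNat = k.toNat + 1 := by omega
        rw [e]
        exact genIn_succ_subset A E₁ _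
  lc := by
    intro k
    rcases le_or_gt k (-1) with hk | hk
    · rw [genTail_of_nonpos _ _ _ (by omega), genTail_of_nonpos _ _ _ (by omega),
        genTail_of_nonpos _ _ _ (by omega)]
    · rcases eq_or_lt_of_le (show 0 ≤ k by omega) with h0 | hpos
      · subst h0
        rw [genTail_of_nonpos _ _ _ (by norm_num), genTail_of_nonpos _ _ _ le_rfl]
        rw [genTail_of_pos _ _ _ (by norm_num)]
        have := prob_le_one hp (genIn A E₁ ((0 : ℤ) + 1).toNat)
        have h2 := prob_nonneg hp (genIn A E₁ ((0 : ℤ) + 1).toNat)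
        nlinarith
      · obtain ⟨n, rfl⟩ : ∃ n : ℕ, k = ((n : ℕ) : ℤ) + 1 := ⟨(k - 1).toNat, by omega⟩
        have e1 : ((n : ℤ) + 1 - 1) = (n : ℤ) := by ring
        have e2 : ((n : ℤ) + 1 + 1) = ((n + 2 : ℕ) : ℤ) := by push_cast; ring
        have e3 : ((n : ℤ) + 1) = ((n + 1 : ℕ) : ℤ) := by push_cast; ring
        rw [e1, e2, e3, genTail_natCast, genTail_natCast, genTail_natCast]
        exact hlc n
  vanish := fun k hk => genTail_eq_zero hA0 E₁ hk

/-- a log-concave tail of the part gives log-concavity at every level -/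
theorem genIn_logconcave_of_isLCTail {p : E → ℝ} {A : Finset E → Prop} {E₁ : Finset E} {N : ℤ}
    (h : IsLCTail (genTail p A E₁) N) (k : ℕ) :
    prob p (genIn A E₁ k) * prob p (genIn A E₁ (k + 2))
      ≤ prob p (genIn A E₁ (k + 1)) * prob p (genIn A E₁ (k + 1)) := by
  have hk := h.lc ((k : ℤ) + 1)
  have e1 : ((k : ℤ) + 1 - 1) = (k : ℤ) := by ring
  have e2 : ((k : ℤ) + 1 + 1) = ((k + 2 : ℕ) : ℤ) := by push_cast; ring
  have e3 : ((k : ℤ) + 1) = ((k + 1 : ℕ) : ℤ) := by push_cast; ring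
  rw [e1, e2, e3, genTail_natCast, genTail_natCast, genTail_natCast] at hk
  exact hk

end Tail

section Atoms

variable {E : Type*} [Fintype E] [DecidableEq E]

omit [Fintype E] in
/-- `k` disjoint witnesses of an increasing `A` inside `S ∩ E₁` are `k` disjoint witnesses of
`T ↦ A (T ∩ E₁)` inside `S`, and conversely -/
lemma kDisj_inter_iff_of_incr {A : Finset E → Prop} (hA : ReimerCube.Incr A) (E₁ : Finset E) :
    ∀ (k : ℕ) (S : Finset E), kDisj A k (S ∩ E₁) ↔ kDisj (fun T => A (T ∩ E₁)) k S
  | 0, S => Iff.rfl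
  | k + 1, S => by
      constructor
      · rintro ⟨K, L, hK, hL, hKL, hAK, hB⟩
        refine ⟨K, L, hK.trans Finset.inter_subset_left, hL.trans Finset.inter_subset_left, hKL, ?_, ?_⟩
        · intro T hT
          apply hAK
          intro e he
          exact Finset.mem_inter.2 ⟨hT he, Finset.mem_of_mem_inter_right (hK he)⟩
        · intro T hT
          rw [← kDisj_inter_iff_of_incr hA E₁ k T]
          apply incr_kDisj _ k _ (hB L le_rfl)
          intro e he
          exact Finset.mem_inter.2 ⟨hT he, Finset.mem_of_mem_inter_right (hL he)⟩
      · rintro ⟨K, L, hK, hL, hKL, hAK, hB⟩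
        refine ⟨K ∩ E₁, L ∩ E₁, Finset.inter_subset_inter hK le_rfl, Finset.inter_subset_inter hL le_rfl,
          Finset.disjoint_of_subset_left Finset.inter_subset_left
            (Finset.disjoint_of_subset_right Finset.inter_subset_left hKL), ?_, ?_⟩
        · intro T hT
          have h := hAK (T ∪ K) Finset.subset_union_right
          apply hA _ h
          intro e he
          rw [Finset.mem_inter, Finset.mem_union] at he
          rcases he.1 with h1 | h1
          · exact h1
          · exact hT (Finset.mem_inter.2 ⟨h1, he.2⟩)
        · intro T hT
          have h := hB (T ∪ L) Finset.subset_union_right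
          rw [← kDisj_inter_iff_of_incr hA E₁ k] at h
          apply incr_kDisj _ k _ h
          intro e he
          rw [Finset.mem_inter, Finset.mem_union] at he
          rcases he.1 with h1 | h1
          · exact h1
          · exact hT (Finset.mem_inter.2 ⟨h1, he.2⟩)

open Classical in
/-- the event as a weighted sum over edge sets -/
lemma prob_genIn_eq_sum_wt (p : E → ℝ) {A : Finset E → Prop} (hA : ReimerCube.Incr A) (E₁ : Finset E)
    (k : ℕ) :
    prob p (genIn A E₁ k)
      = ∑ S ∈ Finset.univ.powerset.filter (kDisj (fun T => A (T ∩ E₁)) k), ReimerCube.wt Finset.univ p S := by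
  rw [prob_eq_sum_wt]
  apply sum_filter_congr_pred
  intro S
  simp only [genIn, Set.mem_setOf_eq, openSet_ofFinset]
  exact kDisj_inter_iff_of_incr hA E₁ k S

omit [Fintype E] in
/-- `T ↦ A (T ∩ E₁)` is increasing when `A` is -/
lemma incr_inter_of_incr {A : Finset E → Prop} (hA : ReimerCube.Incr A) (E₁ : Finset E) :
    ReimerCube.Incr (fun T : Finset E => A (T ∩ E₁)) :=
  fun _ _ h hS => hA (Finset.inter_subset_inter h le_rfl) hS

/-- **BK inside a part**: `P(level ≥ 2) ≤ P(level ≥ 1)²` for an increasing predicate -/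
theorem prob_genIn_two_le {p : E → ℝ} (hp : IsProbVec p) {A : Finset E → Prop} (hA : ReimerCube.Incr A)
    (E₁ : Finset E) :
    prob p (genIn A E₁ 2) ≤ prob p (genIn A E₁ 1) * prob p (genIn A E₁ 1) := by
  classical
  have hp' : ∀ i, 0 ≤ p i ∧ p i ≤ 1 := fun i => ⟨hp.nonneg i, hp.le_one i⟩
  rw [prob_genIn_eq_sum_wt p hA, prob_genIn_eq_sum_wt p hA]
  have h := kDisj_succ_le p hp' _ (incr_inter_of_incr hA E₁) 1
  have h1 : (∑ S ∈ Finset.univ.powerset.filter (kDisj (fun T => A (T ∩ E₁)) 1), ReimerCube.wt Finset.univ p S)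
      = ∑ S ∈ Finset.univ.powerset.filter (fun T => A (T ∩ E₁)), ReimerCube.wt Finset.univ p S := by
    apply sum_filter_congr_pred
    intro S
    exact kDisj_one_iff (incr_inter_of_incr hA E₁) S
  rw [h1] at h ⊢
  exact h

/-- **a part with no three disjoint witnesses is log-concave at every level (by BK alone)** -/
theorem genIn_logconcave_of_no_three {p : E → ℝ} (hp : IsProbVec p) {A : Finset E → Prop}
    (hA : ReimerCube.Incr A) (E₁ : Finset E) (h3 : genIn A E₁ 3 = ∅) (k : ℕ) :
    prob p (genIn A E₁ k) * prob p (genIn A E₁ (k + 2))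
      ≤ prob p (genIn A E₁ (k + 1)) * prob p (genIn A E₁ (k + 1)) := by
  rcases k with _ | k
  · rw [genIn_zero, prob_univ, one_mul]
    exact prob_genIn_two_le hp hA E₁
  · have hvan : genIn A E₁ (k + 1 + 2) = ∅ := by
      apply Set.eq_empty_of_subset_empty
      rw [← h3]
      exact genIn_anti A E₁ (by omega)
    rw [hvan, prob_empty, mul_zero]
    exact mul_nonneg (prob_nonneg hp _) (prob_nonneg hp _)

/-- the atom case as an `IsLCTail` -/
theorem isLCTail_genTail_of_no_three {p : E → ℝ} (hp : IsProbVec p) {A : Finset E → Prop}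
    (hA : ReimerCube.Incr A) (hA0 : ¬ A ∅) (E₁ : Finset E) (h3 : genIn A E₁ 3 = ∅) :
    IsLCTail (genTail p A E₁) ((E₁.card : ℤ) + 1) :=
  isLCTail_genTail hp hA0 E₁ (genIn_logconcave_of_no_three hp hA E₁ h3)

end Atoms

end Summit.Ventures.PercRepro2
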